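import Literature.AlgebraicGeometry.HodgeTheory.HomComplex
import Literature.AlgebraicGeometry.Modules.SheafHomFrames
import Literature.AlgebraicGeometry.Modules.VectorBundleFiniteLocallyFree
import HarnessLib

/-!
# The internal Hom complex into a one-term complex: `𝓗om•(F•, A[0])` is the `A`-valued dual complex of `F•`

Layer `Literature/AlgebraicGeometry/HodgeTheory`; sequel to `HomComplex.lean` (the internal Hom complex
`homComplex X E F = 𝓗om•(E•, F•)`, its summands `ι`, the differentials `ι_D₁`/`ι_D₂`, and the COLUMN isomorphism
`columnIso : 𝓗om•(E₀[0], F•) ≅ 𝓗om(E₀, –) ∘ F•` for a one-term SOURCE). This file is the mirror statement for a one-term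
TARGET. For a scheme `X`, a cochain complex `F•` of `𝒪_X`-modules and an `𝒪_X`-module `A`:

* `HomComplex.rowComplex X F A` — the **`A`-valued dual complex** `m ↦ 𝓗om(F^{-m}, A)` with differential
  `(-1)^{m+1} • 𝓗om(d_F, A)`: the functor `𝓗om(–, A) : Mod(𝒪_X)ᵒᵖ ⥤ Mod(𝒪_X)` applied termwise to the dual indexing
  `dualComplex X F` (whose differential carries the dual sign `(-1)^j`);
* `HomComplex.rowXIso`, **`HomComplex.rowIso X F A : homComplex X F (single₀ X A) ≅ rowComplex X F A`** — in degree `m` only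
  the summand `(q, i) = (0, m)`, `𝓗om(F^{-m}, A[0]⁰) ≅ 𝓗om(F^{-m}, A)`, is non-zero, and on it the total differential is the
  `E`-direction differential `ι_D₂` with sign `(-1)^{m+1}` (`ε₂(0, m) = 1` times the dual sign), i.e. exactly the differential of
  `rowComplex`;
* `HomComplex.rowIso_hom_naturality` — naturality in `A`;
* `HomComplex.isFiniteLocallyFree_single₀_homComplex_X` — for `F•` with finite locally free terms and `A` finite locally free every
  term of `𝓗om•(F•, A[0])` is finite locally free (so `F•^∨ := 𝓗om•(F•, 𝒪_X[0])` is again a bounded complex of vector bundles when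
  `F•` is, with the bounds of `HomComplex.isStrictlyGE/LE`).

Everything is a construction or a proved lemma; no named facts. Motivation: brick B («transpose chain isomorphism
`𝓗om•(F•^∨, E•^∨) ≅ 𝓗om•(E•, F•)`») of the derived-duality item (β3) of the Hodge programme's road №4 (crux 26512) uses
`F•^∨ := 𝓗om•(F•, 𝒪_X[0])`; this file identifies that model with the honest dual complex. Nothing of that crux is asserted here.

## References

* The Stacks project, *More on Algebra*, Section «Hom complexes» (sign conventions). [StacksProject]
* C. A. Weibel, *An introduction to homological algebra* (1994), 2.7.4–2.7.5 (the Hom cochain complex). [Weibel1994]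
* R. Hartshorne, *Algebraic Geometry* (1977), II Ex. 5.1 (b) (`𝓗om` of locally free sheaves). [Hartshorne1977]
-/

noncomputable section

open CategoryTheory CategoryTheory.Limits AlgebraicGeometry Opposite

universe u

namespace Literature.AlgebraicGeometry.HodgeTheory

open Literature.AlgebraicGeometry.Modules Literature.AlgebraicGeometry.Motives

namespace HomComplex

variable (X : Scheme.{u}) (F : CochainComplex X.Modules ℤ) (A : X.Modules)

/-! ## §1 The `A`-valued dual complex -/

/-- **The `A`-valued dual complex of `F•`**: `m ↦ 𝓗om(F^{-m}, A)`, differential `(-1)^{m+1} • 𝓗om(d_F^{-m-1,-m}, A)` — the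
functor `𝓗om(–, A)` (`(sheafHomBifunctor X).flip.obj A : Mod(𝒪_X)ᵒᵖ ⥤ Mod(𝒪_X)`) applied termwise to `dualComplex X F`.
[cite: Weibel1994, 2.7.4–2.7.5 (Hom cochain complex)] -/
abbrev rowComplex : CochainComplex X.Modules ℤ :=
  (((sheafHomBifunctor X).flip.obj A).mapHomologicalComplex (ComplexShape.up ℤ)).obj (dualComplex X F)

/-- The terms of the `A`-valued dual complex (definitional). [cite: Weibel1994, 2.7.4–2.7.5 (Hom cochain complex)] -/
theorem rowComplex_X (m : ℤ) : (rowComplex X F A).X m = sheafHom (F.X (-m)) A := rfl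

/-- The differential of the `A`-valued dual complex: `(-1)^j • 𝓗om(d_F^{-j,-i}, A)` in degrees `i → j`.
[cite: Weibel1994, 2.7.4–2.7.5 (Hom cochain complex)] -/
theorem rowComplex_d (i j : ℤ) :
    (rowComplex X F A).d i j = ((j.negOnePow : ℤˣ) • sheafHomMapLeft (F.d (-j) (-i)) A : sheafHom (F.X (-i)) A ⟶ sheafHom (F.X (-j)) A) := by
  change sheafHomMapLeft ((j.negOnePow : ℤˣ) • F.d (-j) (-i)) A = _
  exact sheafHomMapLeft_units_smul _ _ _ _

/-! ## §2 The degreewise isomorphism `𝓗om•(F•, A[0])^m ≅ 𝓗om(F^{-m}, A)` -/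

/-- `A[0]^q = 0` for `q ≠ 0`. [cite: Weibel1994, 2.7.4–2.7.5 (Hom cochain complex)] -/
lemma isZero_single₀_X' (q : ℤ) (hq : q ≠ 0) : IsZero ((single₀ X A).X q) :=
  HomologicalComplex.isZero_single_obj_X (ComplexShape.up ℤ) 0 A q hq

/-- Degree-`m` comparison `𝓗om•(F•, A[0])^m ⟶ 𝓗om(F^{-m}, A)`: `𝓗om(F^{-m}, A[0]⁰ ≅ A)` on the summand `(0, m)`, else `0`.
[cite: Weibel1994, 2.7.4–2.7.5 (Hom cochain complex)] -/
def rowHom (m : ℤ) : (homComplex X F (single₀ X A)).X m ⟶ sheafHom (F.X (-m)) A :=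
  HomologicalComplex.mapBifunctorDesc fun q i hqi =>
    if hq : q = 0 then
      sheafHomMap (F.X (-i)) (HomologicalComplex.singleObjXIsoOfEq (ComplexShape.up ℤ) 0 A q hq).hom ≫
        sheafHomMapLeft (F.XIsoOfEq (show -m = -i by simp at hqi; lia)).hom A
    else 0

/-- Degree-`m` inverse comparison `𝓗om(F^{-m}, A) ⟶ 𝓗om(F^{-m}, A[0]⁰) ⟶ 𝓗om•(F•, A[0])^m`.
[cite: Weibel1994, 2.7.4–2.7.5 (Hom cochain complex)] -/
def rowInv (m : ℤ) : sheafHom (F.X (-m)) A ⟶ (homComplex X F (single₀ X A)).X m :=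
  sheafHomMap (F.X (-m)) (HomologicalComplex.singleObjXSelf (ComplexShape.up ℤ) 0 A).inv ≫ ι X F (single₀ X A) 0 m m (by simp)

/-- `rowHom` on the summand `(0, m)`. [cite: Weibel1994, 2.7.4–2.7.5 (Hom cochain complex)] -/
lemma ι_rowHom_zero (m : ℤ) :
    ι X F (single₀ X A) 0 m m (by simp) ≫ rowHom X F A m =
      sheafHomMap (F.X (-m)) (HomologicalComplex.singleObjXSelf (ComplexShape.up ℤ) 0 A).hom := by
  refine (HomologicalComplex.ι_mapBifunctorDesc _ 0 m _).trans ?_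
  rw [dif_pos rfl]
  change sheafHomMap (F.X (-m)) (HomologicalComplex.singleObjXIsoOfEq (ComplexShape.up ℤ) 0 A 0 rfl).hom ≫
    sheafHomMapLeft (eqToHom rfl) A = _
  rw [eqToHom_refl, sheafHomMapLeft_id, Category.comp_id]
  rfl

/-- `rowHom` vanishes on the summands `(q, i)`, `q ≠ 0` (their source `𝓗om(F^{-i}, A[0]^q)` is a zero object).
[cite: Weibel1994, 2.7.4–2.7.5 (Hom cochain complex)] -/
lemma ι_rowHom_of_ne (q i m : ℤ) (h : q + i = m) (hq : q ≠ 0) :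
    ι X F (single₀ X A) q i m h ≫ rowHom X F A m = 0 :=
  (isZero_sheafHom_of_isZero_right X _ (isZero_single₀_X' X A q hq)).eq_of_src _ _

/-- `rowHom ≫ rowInv = 𝟙`. [cite: Weibel1994, 2.7.4–2.7.5 (Hom cochain complex)] -/
lemma rowHom_rowInv (m : ℤ) : rowHom X F A m ≫ rowInv X F A m = 𝟙 _ := by
  refine HomologicalComplex.mapBifunctor.hom_ext fun q i hqi => ?_
  change ι X F (single₀ X A) q i m hqi ≫ _ = ι X F (single₀ X A) q i m hqi ≫ _
  by_cases hq : q = 0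
  · subst hq
    obtain rfl : i = m := by simpa using hqi
    rw [reassoc_of% (ι_rowHom_zero X F A i), Category.comp_id, rowInv, ← Category.assoc, ← sheafHomMap_comp, Iso.hom_inv_id,
      sheafHomMap_id, Category.id_comp]
  · exact (isZero_sheafHom_of_isZero_right X _ (isZero_single₀_X' X A q hq)).eq_of_src _ _

/-- `rowInv ≫ rowHom = 𝟙`. [cite: Weibel1994, 2.7.4–2.7.5 (Hom cochain complex)] -/
lemma rowInv_rowHom (m : ℤ) : rowInv X F A m ≫ rowHom X F A m = 𝟙 _ := by
  rw [rowInv, Category.assoc, ι_rowHom_zero, ← sheafHomMap_comp, Iso.inv_hom_id, sheafHomMap_id]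

/-- **Degreewise isomorphism `𝓗om•(F•, A[0])^m ≅ 𝓗om(F^{-m}, A)`.** [cite: Weibel1994, 2.7.4–2.7.5 (Hom cochain complex)] -/
def rowXIso (m : ℤ) : (homComplex X F (single₀ X A)).X m ≅ sheafHom (F.X (-m)) A where
  hom := rowHom X F A m
  inv := rowInv X F A m
  hom_inv_id := rowHom_rowInv X F A m
  inv_hom_id := rowInv_rowHom X F A m

/-- The `F`-direction differential of `𝓗om•(F•, A[0])` vanishes on every summand (`A[0]` has zero differential).
[cite: Weibel1994, 2.7.4–2.7.5 (Hom cochain complex)] -/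
lemma ι_row_D₁_eq_zero (q i m m' : ℤ) (h : q + i = m) (h' : q + 1 + i = m') :
    ι X F (single₀ X A) q i m h ≫
        HomologicalComplex.mapBifunctor.D₁ (single₀ X A) (dualComplex X F) (sheafHomBifunctor X).flip (ComplexShape.up ℤ) m m' = 0 := by
  rw [ι_D₁ X F (single₀ X A) q i m m' h h', HomologicalComplex.single_obj_d]
  change (sheafHomFunctor (F.X (-i))).map 0 ≫ _ = 0
  rw [Functor.map_zero, zero_comp]

/-! ## §3 The row isomorphism -/

/-- **THE ROW ISOMORPHISM** `𝓗om•(F•, A[0]) ≅ (m ↦ 𝓗om(F^{-m}, A), (-1)^{m+1} • 𝓗om(d_F, A))`: for a target concentrated in degree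
`0` the internal Hom complex is the `A`-valued dual complex of `F•` (on the summand `(0, m)` the total differential is the `E`-direction
`ι_D₂` with its sign `(-1)^{m+1}`; the `F`-direction vanishes). [cite: StacksProject, More on Algebra, Section «Hom complexes»]
[cite: Weibel1994, 2.7.4–2.7.5 (Hom cochain complex)] -/
def rowIso : homComplex X F (single₀ X A) ≅ rowComplex X F A :=
  HomologicalComplex.Hom.isoOfComponents (fun m => rowXIso X F A m) fun m m' hmm' => by
    obtain rfl : m + 1 = m' := hmm'
    -- restate with the differential of `rowComplex` unfolded to `𝓗om((-1)^{m+1} • d_F, A)` (definitional), so that every object is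
    -- syntactically `𝓗om(F^{-·}, A)`
    change rowHom X F A m ≫ sheafHomMapLeft (((m + 1).negOnePow : ℤˣ) • F.d (-(m + 1)) (-m)) A =
      (homComplex X F (single₀ X A)).d m (m + 1) ≫ rowHom X F A (m + 1)
    rw [sheafHomMapLeft_units_smul, HomologicalComplex.mapBifunctor.d_eq, Preadditive.add_comp]
    refine HomologicalComplex.mapBifunctor.hom_ext fun q i hqi => ?_
    change ι X F (single₀ X A) q i m hqi ≫ _ = ι X F (single₀ X A) q i m hqi ≫ _
    by_cases hq : q = 0
    · subst hq
      obtain rfl : i = m := by simpa using hqi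
      rw [Preadditive.comp_add, reassoc_of% (ι_row_D₁_eq_zero X F A 0 i i (i + 1) (by simp) (by lia)), zero_comp, zero_add,
        reassoc_of% (ι_D₂ X F (single₀ X A) 0 i i (i + 1) (by simp) (by lia)), Linear.units_smul_comp, Category.assoc,
        ι_rowHom_zero, reassoc_of% (ι_rowHom_zero X F A i), Linear.comp_units_smul]
      congr 1
    · rw [reassoc_of% (ι_rowHom_of_ne X F A q i m hqi hq), zero_comp]
      exact (isZero_sheafHom_of_isZero_right X _ (isZero_single₀_X' X A q hq)).eq_of_src _ _

/-- Components of the row isomorphism. [cite: Weibel1994, 2.7.4–2.7.5 (Hom cochain complex)] -/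
@[simp]
theorem rowIso_hom_f (m : ℤ) : (rowIso X F A).hom.f m = rowHom X F A m := rfl

/-- Components of the inverse row isomorphism. [cite: Weibel1994, 2.7.4–2.7.5 (Hom cochain complex)] -/
@[simp]
theorem rowIso_inv_f (m : ℤ) : (rowIso X F A).inv.f m = rowInv X F A m := rfl

variable {A} {A' : X.Modules} (g : A ⟶ A')

/-- **The row isomorphism is natural in `A`**: `𝓗om•(F•, g[0]) ≫ row_{A'} = row_A ≫ 𝓗om(–, g)•`.
[cite: Weibel1994, 2.7.4–2.7.5 (Hom cochain complex)] -/
theorem rowIso_hom_naturality :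
    map X F ((HomologicalComplex.single X.Modules (ComplexShape.up ℤ) 0).map g) ≫ (rowIso X F A').hom =
      (rowIso X F A).hom ≫
        (NatTrans.mapHomologicalComplex ((sheafHomBifunctor X).flip.map g) (ComplexShape.up ℤ)).app (dualComplex X F) := by
  refine HomologicalComplex.hom_ext _ _ fun m => ?_
  change (map X F _).f m ≫ rowHom X F A' m = rowHom X F A m ≫ sheafHomMap (F.X (-m)) g
  refine HomologicalComplex.mapBifunctor.hom_ext fun q i hqi => ?_
  change ι X F (single₀ X A) q i m hqi ≫ _ = ι X F (single₀ X A) q i m hqi ≫ _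
  by_cases hq : q = 0
  · subst hq
    obtain rfl : i = m := by simpa using hqi
    rw [reassoc_of% (ι_map X F ((HomologicalComplex.single X.Modules (ComplexShape.up ℤ) 0).map g) 0 i i hqi), ι_rowHom_zero,
      reassoc_of% (ι_rowHom_zero X F A i), HomologicalComplex.single_map_f_self, ← sheafHomMap_comp, ← sheafHomMap_comp]
    simp only [Category.assoc, Iso.inv_hom_id, Category.comp_id]
  · rw [reassoc_of% (ι_rowHom_of_ne X F A q i m hqi hq), zero_comp]
    exact (isZero_sheafHom_of_isZero_right X _ (isZero_single₀_X' X A q hq)).eq_of_src _ _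

/-! ## §4 Vector-bundle terms -/

variable (A)

/-- **The terms of `𝓗om•(F•, A[0])` are finite locally free** when the terms of `F•` and `A` are (`𝓗om•(F•, A[0])^m ≅ 𝓗om(F^{-m}, A)`,
`isFiniteLocallyFree_sheafHom'`). In particular `F•^∨ := 𝓗om•(F•, 𝒪_X[0])` is a complex of vector bundles for `F•` one.
[cite: Hartshorne1977, II Ex. 5.1 (b)] -/
theorem isFiniteLocallyFree_single₀_homComplex_X (hF : ∀ i, IsFiniteLocallyFree (F.X i)) (hA : IsFiniteLocallyFree A) (m : ℤ) :
    IsFiniteLocallyFree ((homComplex X F (single₀ X A)).X m) :=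
  isFiniteLocallyFree_of_iso (rowXIso X F A m).symm (isFiniteLocallyFree_sheafHom' (hF (-m)) hA)

end HomComplex

end Literature.AlgebraicGeometry.HodgeTheory

end
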